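import Literature.Analysis.DeBrangesSpaces.BurnolCosineKernelEntire
import Literature.Analysis.Fourier.L2FourierReflection
import Literature.Analysis.Fourier.L2FourierConj
import Literature.Analysis.FunctionSpaces.PlancherelL1L2
import HarnessLib

/-!
# Mellin transforms of Sonine functions are entire (de Branges 1964; Burnol's elementary proof)

LINE 1 — LABEL: RH-FREE (a theorem about the Fourier transform on `L²(ℝ)` and Mellin transforms of
functions vanishing near `0` together with their Fourier transform; the Riemann zeta function does not
occur). FRAMING (cell rh-crit, D-0074): corpus theorems are RH-FREE literature; nothing here is worded as
progress toward RH. bears_on: B-C/B-P (LADDER-RH COLUMN 6, de Branges framework). WHAT THIS IS NOT: not a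
route, not a criterion — it is the existence theorem behind the "evaluators" of the de Branges/Burnol
Sonine spaces; discharging it fixes the vocabulary of the corpus and does not move RH. Nothing here bears
on the truth of RH.

Source: J.-F. Burnol, C. R. Acad. Sci. Paris Sér. I **333** (2001) 201–206 = arXiv:math/0105120
[Burnol2001CRAS], §1 (TeX of record `dbl/src/Burnol2001CRAS_arXivmath0105120.tex`, l.283–386):
Théorème 1.1 ("voir [13]" = L. de Branges, *Self-reciprocal functions*, J. Math. Anal. Appl. 9 (1964)
433–457 [deBranges1964]): *Toute fonction d'un espace `K_{a,b}` a une transformée de Mellin qui est une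
fonction entière*, with Burnol's ELEMENTARY proof through the identity
(1.2) `∫_0^∞ f(t)t^{s−1}dt = ∫_b^∞ [((1−s)∫_a^∞ sin(2πut)t^{s−2}dt − a^{s−1}sin(2πau))/(πu)] 𝓕₊(f)(u) du`,
i.e. `f̂(w) = (𝓕₊f, 𝟙_{u≥b}C_a(u,w)]` (proof of Thm. 1.4, TeX l.378–379), and the trivial zeros at
`1, 3, 5, …` (Théorème 1.4, first clause).

## What is PROVED (theorem-only module; the kernel `C_a(u,w)` and `G_F(w) = ∫_b^∞ F(u)C_a(u,w)du` are
## the objects `SonineMellin.cosKernel`, `SonineMellin.sonineMellinExt` of `BurnolCosineKernelEntire.lean`)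

For `f ∈ L²(ℝ)` a.e. even with `f = 0` a.e. on `[−a,a]` and `𝓕f = 0` a.e. on `[−b,b]` (`a, b > 0`; this is
membership in Connes–Consani's / Burnol's `K_{a,b} = soninSpace a b`), with `F = 𝓕f`:
* `differentiable_sonineMellinExt`: `G_F` is entire (any `F ∈ L²`); `exists_bound_sonineMellinExt`:
  `‖G_F(w)‖ ≤ C(a,b,R)‖F‖` on `‖w‖ ≤ R`;
* `sonineMellinExt_eq_mellin_of_neg` ((1.2) on `Re w < 0`), `differentiableOn_mellin`,
  `sonineMellinExt_eq_mellin` ((1.2) on `Re w < 1/2`, identity theorem);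
* `sonineMellinExt_one_add_two_mul`: `G_F(1+2j) = 0`;
* DISCHARGE `Burnol2001.Burnol2001CRAS_thm1_1_holds` of the named fact
  `Literature.Analysis.DeBrangesSpaces.Burnol2001.Burnol2001CRAS_thm1_1`, and the first clause of
  Théorème 1.4 for EVERY entire continuation, `Burnol2001.Burnol2001CRAS_thm1_4_i` (the fact
  `Burnol2001CRAS_thm1_4` keeps its second clause "ce sont leurs seuls zéros communs" undischarged).
The right-Mellin corollary (Burnol 2004 Thm. 2.1 = de Branges 1964, with the continuity of the
evaluations) is `Literature/NumberTheory/LFunctions/SonineCompletedMellinEntire.lean`.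

DEVIATIONS FROM THE PRINTED PROOF (declared): (a) Burnol continues `f̂` from `Re s < 1` to `ℂ` "par
exemple" by the Mellin–Plancherel identity (1.1); we use instead that the right-hand side of (1.2) is
ALREADY entire once `C_a(u,·)` is (his own remark "Pour tout nombre complexe `w` … `f̂(w) =
(𝓕₊(f), φ^w_{a,b}]`", TeX l.378–379), so (1.1) is not needed; (b) the trivial zeros come from the
terminating integration by parts `C_a(u,1+2j) = −𝓕(x^{2j}𝟙_{|x|<a})(u)` and `∫ 𝓕f·𝓕h = ∫ f·h = 0`,
instead of (1.1). Mathlib's `𝓕` on `L²(ℝ)` (kernel `e^{−2πixu}`) restricted to even classes is Burnol's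
cosine transform `𝓕₊`; all pairings are the bilinear `∫ φψ`.
-/

noncomputable section

open _root_.MeasureTheory _root_.Complex _root_.Filter _root_.Set SchwartzMap FourierTransform
open scoped Topology Real ComplexConjugate ENNReal

namespace Literature.Analysis.DeBrangesSpaces

namespace SonineMellin

/-- The `L²` Fourier transform of an a.e.-even class is a.e. even (`𝓕R = R𝓕`, `Ru = u`). [folklore] -/
private theorem fourier_even {f : Lp ℂ 2 (volume : Measure ℝ)}
    (hf : ∀ᵐ x : ℝ, (f : ℝ → ℂ) (-x) = (f : ℝ → ℂ) x) :
    ∀ᵐ x : ℝ, ((𝓕 f : Lp ℂ 2 (volume : Measure ℝ)) : ℝ → ℂ) (-x) =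
      ((𝓕 f : Lp ℂ 2 (volume : Measure ℝ)) : ℝ → ℂ) x := by
  have h1 : Lp.compMeasurePreserving (fun x : ℝ ↦ -x) (Measure.measurePreserving_neg (volume : Measure ℝ))
      f = f := by
    apply Lp.ext
    filter_upwards [Literature.Analysis.Fourier.coeFn_compNeg f, hf] with x h1 h2
    rw [h1, h2]
  have h2 := Literature.Analysis.Fourier.fourier_compNeg f
  rw [h1] at h2
  have h3 := Literature.Analysis.Fourier.coeFn_compNeg (𝓕 f : Lp ℂ 2 (volume : Measure ℝ))
  rw [← h2] at h3
  filter_upwards [h3] with x hx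
  exact hx.symm

/-- `|e^{iλt}| = 1` for real `λ, t`. [folklore] -/
private theorem norm_cexp_I_mul' (l t : ℝ) : ‖cexp (I * l * t)‖ = 1 := by
  rw [show (I * l * t : ℂ) = ((l * t : ℝ) : ℂ) * I by push_cast; ring]
  exact Complex.norm_exp_ofReal_mul_I _

/-! ### even functions: integrability and integrals -/

/-- `∫_ℝ h = ∫_{(0,∞)} (h(x) + h(−x)) dx` for integrable `h`. [folklore] -/
private theorem integral_eq_integral_Ioi_add_neg {h : ℝ → ℂ} (hh : Integrable h) :
    ∫ x, h x = ∫ x in Ioi 0, (h x + h (-x)) := by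
  have h1 : IntegrableOn h (Iic 0) := hh.integrableOn
  have h2 : IntegrableOn h (Ioi 0) := hh.integrableOn
  have h3 : IntegrableOn (fun x ↦ h (-x)) (Ioi 0) := hh.comp_neg.integrableOn
  rw [← intervalIntegral.integral_Iic_add_Ioi h1 h2, integral_add h2 h3, add_comm]
  congr 1
  rw [integral_comp_neg_Ioi]; simp

/-- An even function integrable on `(0,∞)` is integrable on `ℝ`. [folklore] -/
private theorem integrable_of_even {h : ℝ → ℂ} (heven : ∀ x, h (-x) = h x) (hh : IntegrableOn h (Ioi 0)) :
    Integrable h := by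
  have h1 : IntegrableOn h (Ici 0) := (integrableOn_Ici_iff_integrableOn_Ioi).mpr hh
  have h2 : IntegrableOn h (Iic 0) := by
    have hmp := Measure.measurePreserving_neg (volume : Measure ℝ)
    have hme : MeasurableEmbedding (fun x : ℝ ↦ -x) := (Homeomorph.neg ℝ).measurableEmbedding
    have := (hmp.integrableOn_comp_preimage hme (f := h) (s := Ici 0)).mpr h1
    have hpre : (fun x : ℝ ↦ -x) ⁻¹' (Ici 0) = Iic 0 := by ext x; simp
    rw [hpre] at this
    refine this.congr_fun (fun x _ ↦ ?_) measurableSet_Iic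
    simp [heven]
  have := h2.union hh
  rwa [Iic_union_Ioi, integrableOn_univ] at this

/-- `∫_{(0,∞)} φ = ∫_{(a,∞)} φ` for `φ` vanishing on `(0,a]`. [folklore] -/
private theorem setIntegral_Ioi_eq_Ioi {φ : ℝ → ℂ} {a : ℝ} (ha : 0 ≤ a) (hφ : IntegrableOn φ (Ioi 0))
    (hz : ∀ x ∈ Ioc 0 a, φ x = 0) : ∫ x in Ioi 0, φ x = ∫ x in Ioi a, φ x := by
  rw [← Ioc_union_Ioi_eq_Ioi ha, setIntegral_union (Set.Ioc_disjoint_Ioi le_rfl) measurableSet_Ioi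
    (hφ.mono_set Ioc_subset_Ioi_self) (hφ.mono_set (Ioi_subset_Ioi ha))]
  have e2 : ∫ x in Ioc 0 a, φ x = 0 := by
    refine integral_eq_zero_of_ae ?_
    filter_upwards [ae_restrict_mem measurableSet_Ioc] with x hx
    exact hz x hx
  rw [e2, zero_add]

/-! ### the test function `g_w(x) = |x|^{w-1} 𝟙_{|x|>a}` -/


/-- The test function `g_w(x) = |x|^{w−1}𝟙_{|x|>a}` (Burnol's `𝟙_{t≥a}t^{w−1}`, made even) is even. [folklore] -/
private theorem gw_neg (a : ℝ) (w : ℂ) (x : ℝ) : (Set.indicator {x : ℝ | a < |x|} (fun x : ℝ ↦ ((|x| : ℝ) : ℂ) ^ (w - 1))) (-x) = (Set.indicator {x : ℝ | a < |x|} (fun x : ℝ ↦ ((|x| : ℝ) : ℂ) ^ (w - 1))) x := by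
  simp [Set.indicator, abs_neg]

/-- On `x > 0`, `g_w(x) = 𝟙_{(a,∞)}(x)·x^{w−1}`. [folklore] -/
private theorem gw_eq_indicator_of_pos (a : ℝ) (w : ℂ) {x : ℝ} (hx : 0 < x) :
    (Set.indicator {x : ℝ | a < |x|} (fun x : ℝ ↦ ((|x| : ℝ) : ℂ) ^ (w - 1))) x = Set.indicator (Ioi a) (fun x : ℝ ↦ (x : ℂ) ^ (w - 1)) x := by
  simp [Set.indicator, abs_of_pos hx]

/-- `g_w` is measurable. [folklore] -/
private theorem measurable_gw (a : ℝ) (w : ℂ) : Measurable (Set.indicator {x : ℝ | a < |x|} (fun x : ℝ ↦ ((|x| : ℝ) : ℂ) ^ (w - 1))) := by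
  refine Measurable.indicator ?_ (isOpen_lt continuous_const continuous_abs).measurableSet
  exact (Complex.measurable_ofReal.comp continuous_abs.measurable).pow_const _

/-- `g_w ∈ L¹((0,∞))` for `Re w < 0`. [folklore] -/
private theorem integrableOn_gw_Ioi {a : ℝ} (ha : 0 < a) {w : ℂ} (hw : w.re < 0) :
    IntegrableOn (Set.indicator {x : ℝ | a < |x|} (fun x : ℝ ↦ ((|x| : ℝ) : ℂ) ^ (w - 1))) (Ioi 0) := by
  have h1 : IntegrableOn (fun x : ℝ ↦ (x : ℂ) ^ (w - 1)) (Ioi a) :=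
    integrableOn_Ioi_cpow_of_lt (by simp; linarith) ha
  have h2 : IntegrableOn (Set.indicator (Ioi a) (fun x : ℝ ↦ (x : ℂ) ^ (w - 1))) (Ioi 0) :=
    (h1.integrable_indicator measurableSet_Ioi).integrableOn
  exact h2.congr_fun (fun x hx ↦ (gw_eq_indicator_of_pos a w hx).symm) measurableSet_Ioi

/-- `g_w ∈ L¹(ℝ)` for `Re w < 0`. [folklore] -/
private theorem integrable_gw {a : ℝ} (ha : 0 < a) {w : ℂ} (hw : w.re < 0) : Integrable (Set.indicator {x : ℝ | a < |x|} (fun x : ℝ ↦ ((|x| : ℝ) : ℂ) ^ (w - 1))) :=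
  integrable_of_even (gw_neg a w) (integrableOn_gw_Ioi ha hw)

/-- `g_w ∈ L²(ℝ)` for `Re w < 1/2` ("`∫ f(t)t^{s−1}dt` est analytique dans le demi-plan `Re(s) < 1/2`",
TeX l.288–290, by Cauchy–Schwarz against this function). [folklore] -/
private theorem memLp_gw {a : ℝ} (ha : 0 < a) {w : ℂ} (hw : w.re < 1 / 2) : MemLp (Set.indicator {x : ℝ | a < |x|} (fun x : ℝ ↦ ((|x| : ℝ) : ℂ) ^ (w - 1))) 2 volume := by
  rw [memLp_two_iff_integrable_sq_norm (measurable_gw a w).aestronglyMeasurable]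
  have heven : ∀ x, (fun x ↦ ‖(Set.indicator {x : ℝ | a < |x|} (fun x : ℝ ↦ ((|x| : ℝ) : ℂ) ^ (w - 1))) x‖ ^ 2) (-x) = (fun x ↦ ‖(Set.indicator {x : ℝ | a < |x|} (fun x : ℝ ↦ ((|x| : ℝ) : ℂ) ^ (w - 1))) x‖ ^ 2) x := by
    intro x; simp [gw_neg]
  -- work with the complex-valued version to reuse `integrable_of_even`
  have h1 : IntegrableOn (fun x : ℝ ↦ x ^ (2 * (w.re - 1))) (Ioi a) :=
    integrableOn_Ioi_rpow_of_lt (by linarith) ha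
  have h2 : IntegrableOn (fun x ↦ ‖(Set.indicator {x : ℝ | a < |x|} (fun x : ℝ ↦ ((|x| : ℝ) : ℂ) ^ (w - 1))) x‖ ^ 2) (Ioi 0) := by
    have h3 : IntegrableOn (Set.indicator (Ioi a) (fun x : ℝ ↦ x ^ (2 * (w.re - 1)))) (Ioi 0) :=
      (h1.integrable_indicator measurableSet_Ioi).integrableOn
    refine h3.congr_fun (fun x hx ↦ ?_) measurableSet_Ioi
    rw [gw_eq_indicator_of_pos a w hx]
    by_cases hxa : a < x
    · rw [Set.indicator_of_mem (show x ∈ Ioi a from hxa), Set.indicator_of_mem (show x ∈ Ioi a from hxa),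
        norm_cpow_eq_rpow_re_of_pos hx, ← Real.rpow_natCast, ← Real.rpow_mul hx.le]
      congr 1; simp; ring
    · rw [Set.indicator_of_notMem (show x ∉ Ioi a from hxa),
        Set.indicator_of_notMem (show x ∉ Ioi a from hxa)]
      simp
  -- integrable on ℝ by evenness (real-valued version of `integrable_of_even`)
  have h4 : IntegrableOn (fun x ↦ ‖(Set.indicator {x : ℝ | a < |x|} (fun x : ℝ ↦ ((|x| : ℝ) : ℂ) ^ (w - 1))) x‖ ^ 2) (Ici 0) := (integrableOn_Ici_iff_integrableOn_Ioi).mpr h2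
  have h5 : IntegrableOn (fun x ↦ ‖(Set.indicator {x : ℝ | a < |x|} (fun x : ℝ ↦ ((|x| : ℝ) : ℂ) ^ (w - 1))) x‖ ^ 2) (Iic 0) := by
    have hmp := Measure.measurePreserving_neg (volume : Measure ℝ)
    have hme : MeasurableEmbedding (fun x : ℝ ↦ -x) := (Homeomorph.neg ℝ).measurableEmbedding
    have := (hmp.integrableOn_comp_preimage hme (f := fun x ↦ ‖(Set.indicator {x : ℝ | a < |x|} (fun x : ℝ ↦ ((|x| : ℝ) : ℂ) ^ (w - 1))) x‖ ^ 2) (s := Ici 0)).mpr h4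
    have hpre : (fun x : ℝ ↦ -x) ⁻¹' (Ici 0) = Iic 0 := by ext x; simp
    rw [hpre] at this
    refine this.congr_fun (fun x _ ↦ ?_) measurableSet_Iic
    simp [gw_neg]
  have := h5.union h2
  rwa [Iic_union_Ioi, integrableOn_univ] at this

/-- **The Fourier transform of `g_w = |x|^{w−1}𝟙_{|x|>a}` is the kernel `C_a(u,w)`** (`Re w < 0`,
`u ≠ 0`): `∫ |x|^{w−1}𝟙_{|x|>a} e^{−2πixu} dx = 2∫_a^∞ cos(2πut)t^{w−1}dt` — Burnol's
`φ^w_{a,b}(u) = 𝟙_{u≥b}C_a(u,w)`, "`𝓕₊` of `𝟙_{t≥a}t^{s−1}`". [cite: Burnol2001CRAS, eq. (1.2) and Théorème 1.1 (TeX l.320–332)] -/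
theorem fourierIntegral_gw {a : ℝ} (ha : 0 < a) {w : ℂ} (hw : w.re < 0) {u : ℝ} (hu : u ≠ 0) :
    𝓕 (Set.indicator {x : ℝ | a < |x|} (fun x : ℝ ↦ ((|x| : ℝ) : ℂ) ^ (w - 1))) u = cosKernel a u w := by
  rw [Real.fourier_real_eq_integral_exp_smul]
  simp only [smul_eq_mul]
  set H : ℝ → ℂ := fun v ↦ cexp (↑(-2 * π * v * u) * I) * (Set.indicator {x : ℝ | a < |x|} (fun x : ℝ ↦ ((|x| : ℝ) : ℂ) ^ (w - 1))) v with hH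
  have hHi : Integrable H := by
    refine (integrable_gw ha hw).bdd_mul (c := 1) (Continuous.aestronglyMeasurable (by fun_prop)) ?_
    refine Eventually.of_forall fun v ↦ ?_
    rw [show (↑(-2 * π * v * u) * I : ℂ) = I * ((-(2 * π * u) : ℝ) : ℂ) * v by push_cast; ring,
      norm_cexp_I_mul']
  rw [integral_eq_integral_Ioi_add_neg hHi]
  have h2l : (2 * π * u : ℝ) ≠ 0 := by positivity
  -- on `(0,∞)` the integrand is the indicator of `(a,∞)` of `v^{w-1}(e^{-iλv} + e^{iλv})`
  set φ : ℝ → ℂ := fun v ↦ (cexp (I * (2 * π * u) * v) + cexp (I * (-(2 * π * u)) * v)) *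
    (v : ℂ) ^ (w - 1) with hφ
  have hφi : IntegrableOn φ (Ioi a) := by
    have h1 : IntegrableOn (fun x : ℝ ↦ (x : ℂ) ^ (w - 1)) (Ioi a) :=
      integrableOn_Ioi_cpow_of_lt (by simp; linarith) ha
    refine h1.bdd_mul (c := 2) (Continuous.aestronglyMeasurable (by fun_prop)) ?_
    refine Eventually.of_forall fun v ↦ ?_
    calc ‖cexp (I * (2 * π * u) * v) + cexp (I * (-(2 * π * u)) * v)‖
        ≤ ‖cexp (I * (2 * π * u) * v)‖ + ‖cexp (I * (-(2 * π * u)) * v)‖ := norm_add_le _ _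
      _ = 2 := by
          rw [show (I * (2 * π * u) * v : ℂ) = I * ((2 * π * u : ℝ) : ℂ) * v by push_cast; ring,
            show (I * (-(2 * π * u)) * v : ℂ) = I * ((-(2 * π * u) : ℝ) : ℂ) * v by push_cast; ring,
            norm_cexp_I_mul', norm_cexp_I_mul']; norm_num
  have hEq : ∀ v ∈ Ioi (0 : ℝ), H v + H (-v) = Set.indicator (Ioi a) φ v := by
    intro v hv
    rw [hH]; simp only
    rw [gw_neg, gw_eq_indicator_of_pos a w hv]
    by_cases hva : a < v
    · rw [Set.indicator_of_mem (show v ∈ Ioi a from hva), Set.indicator_of_mem (show v ∈ Ioi a from hva),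
        hφ]
      simp only
      rw [show (↑(-2 * π * v * u) * I : ℂ) = I * (-(2 * π * u)) * v by push_cast; ring,
        show (↑(-2 * π * (-v) * u) * I : ℂ) = I * (2 * π * u) * v by push_cast; ring]
      ring
    · rw [Set.indicator_of_notMem (show v ∉ Ioi a from hva),
        Set.indicator_of_notMem (show v ∉ Ioi a from hva)]
      simp
  rw [setIntegral_congr_fun measurableSet_Ioi hEq, setIntegral_indicator measurableSet_Ioi,
    show Ioi (0 : ℝ) ∩ Ioi a = Ioi a from by
      rw [Set.inter_eq_right]; exact Ioi_subset_Ioi ha.le]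
  -- split the two exponentials
  rw [hφ]
  simp only [add_mul]
  rw [integral_add]
  · rw [cosKernel, ibpEntire_eq_integral h2l ha (by simp; linarith),
      ibpEntire_eq_integral (neg_ne_zero.mpr h2l) ha (by simp; linarith)]
    push_cast
    ring_nf
  · have h1 : IntegrableOn (fun x : ℝ ↦ (x : ℂ) ^ (w - 1)) (Ioi a) :=
      integrableOn_Ioi_cpow_of_lt (by simp; linarith) ha
    refine h1.bdd_mul (c := 1) (Continuous.aestronglyMeasurable (by fun_prop)) ?_
    refine Eventually.of_forall fun v ↦ ?_
    rw [show (I * (2 * π * u) * v : ℂ) = I * ((2 * π * u : ℝ) : ℂ) * v by push_cast; ring,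
      norm_cexp_I_mul']
  · have h1 : IntegrableOn (fun x : ℝ ↦ (x : ℂ) ^ (w - 1)) (Ioi a) :=
      integrableOn_Ioi_cpow_of_lt (by simp; linarith) ha
    refine h1.bdd_mul (c := 1) (Continuous.aestronglyMeasurable (by fun_prop)) ?_
    refine Eventually.of_forall fun v ↦ ?_
    rw [show (I * (-(2 * π * u)) * v : ℂ) = I * ((-(2 * π * u) : ℝ) : ℂ) * v by push_cast; ring,
      norm_cexp_I_mul']


/-! ### the test function `h_j(x) = x^{2j} 𝟙_{|x|<a}` -/


/-- The test function `h_j(x) = x^{2j}𝟙_{|x|<a}` (Burnol's `𝟙_{t≤a}t^{2j}`, made even) is even. [folklore] -/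
private theorem hj_neg (a : ℝ) (j : ℕ) (x : ℝ) : (Set.indicator {x : ℝ | |x| < a} (fun x : ℝ ↦ (x : ℂ) ^ (2 * j))) (-x) = (Set.indicator {x : ℝ | |x| < a} (fun x : ℝ ↦ (x : ℂ) ^ (2 * j))) x := by
  simp only [Set.indicator, mem_setOf_eq, abs_neg]
  split_ifs <;> simp [(even_two_mul j).neg_pow]

/-- On `x > 0`, `h_j(x) = 𝟙_{(−∞,a)}(x)·x^{2j}`. [folklore] -/
private theorem hj_eq_indicator_of_pos (a : ℝ) (j : ℕ) {x : ℝ} (hx : 0 < x) :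
    (Set.indicator {x : ℝ | |x| < a} (fun x : ℝ ↦ (x : ℂ) ^ (2 * j))) x = Set.indicator (Iio a) (fun x : ℝ ↦ (x : ℂ) ^ (2 * j)) x := by
  simp [Set.indicator, abs_of_pos hx]

/-- `h_j` is measurable. [folklore] -/
private theorem measurable_hj (a : ℝ) (j : ℕ) : Measurable (Set.indicator {x : ℝ | |x| < a} (fun x : ℝ ↦ (x : ℂ) ^ (2 * j))) := by
  refine Measurable.indicator ?_ (isOpen_lt continuous_abs continuous_const).measurableSet
  exact (Complex.measurable_ofReal.pow_const _)

/-- `{|x| < a} = (−a, a)`. [folklore] -/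
private theorem abs_lt_eq_Ioo (a : ℝ) : {x : ℝ | |x| < a} = Ioo (-a) a := by
  ext x; simp [abs_lt]

/-- `h_j ∈ L¹(ℝ)`. [folklore] -/
private theorem integrable_hj (a : ℝ) (j : ℕ) : Integrable (Set.indicator {x : ℝ | |x| < a} (fun x : ℝ ↦ (x : ℂ) ^ (2 * j))) := by
  rw [integrable_indicator_iff (isOpen_lt continuous_abs continuous_const).measurableSet, abs_lt_eq_Ioo]
  exact ((by fun_prop : Continuous fun x : ℝ ↦ (x : ℂ) ^ (2 * j)).integrableOn_Icc).mono_set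
    Ioo_subset_Icc_self

/-- `h_j ∈ L²(ℝ)`. [folklore] -/
private theorem memLp_hj (a : ℝ) (j : ℕ) : MemLp (Set.indicator {x : ℝ | |x| < a} (fun x : ℝ ↦ (x : ℂ) ^ (2 * j))) 2 volume := by
  rw [memLp_two_iff_integrable_sq_norm (measurable_hj a j).aestronglyMeasurable]
  have h : (fun x ↦ ‖(Set.indicator {x : ℝ | |x| < a} (fun x : ℝ ↦ (x : ℂ) ^ (2 * j))) x‖ ^ 2) = Set.indicator {x : ℝ | |x| < a} (fun x : ℝ ↦ (x ^ 2) ^ (2 * j)) := by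
    ext x
    simp only [Set.indicator, mem_setOf_eq]
    split_ifs
    · rw [norm_pow, Complex.norm_real, Real.norm_eq_abs, ← pow_mul, ← sq_abs, ← pow_mul]; ring_nf
    · simp
  rw [h, integrable_indicator_iff (isOpen_lt continuous_abs continuous_const).measurableSet,
    abs_lt_eq_Ioo]
  exact ((by fun_prop : Continuous fun x : ℝ ↦ (x ^ 2) ^ (2 * j)).integrableOn_Icc).mono_set
    Ioo_subset_Icc_self

/-- **The Fourier transform of `h_j = x^{2j}𝟙_{|x|<a}`**: `∫_0^a (e^{2πiut}+e^{−2πiut})t^{2j}dt =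
2∫_0^a cos(2πut)t^{2j}dt = D_a(u,1+2j)` ("`𝓕₊(𝟙_{t≤a}t^{2j})(u)`", Lemme 1.3).
[cite: Burnol2001CRAS, Lemme 1.3 (TeX l.358–367)] -/
theorem fourierIntegral_hj {a : ℝ} (ha : 0 < a) (j : ℕ) (u : ℝ) :
    𝓕 (Set.indicator {x : ℝ | |x| < a} (fun x : ℝ ↦ (x : ℂ) ^ (2 * j))) u = oscMoment (2 * π * u) a (2 * j) + oscMoment (-(2 * π * u)) a (2 * j) := by
  rw [Real.fourier_real_eq_integral_exp_smul]
  simp only [smul_eq_mul]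
  set H : ℝ → ℂ := fun v ↦ cexp (↑(-2 * π * v * u) * I) * (Set.indicator {x : ℝ | |x| < a} (fun x : ℝ ↦ (x : ℂ) ^ (2 * j))) v with hH
  have hHi : Integrable H := by
    refine (integrable_hj a j).bdd_mul (c := 1) (Continuous.aestronglyMeasurable (by fun_prop)) ?_
    refine Eventually.of_forall fun v ↦ ?_
    rw [show (↑(-2 * π * v * u) * I : ℂ) = I * ((-(2 * π * u) : ℝ) : ℂ) * v by push_cast; ring,
      norm_cexp_I_mul']
  rw [integral_eq_integral_Ioi_add_neg hHi]
  set ψ : ℝ → ℂ := fun v ↦ (cexp (I * (2 * π * u) * v) + cexp (I * (-(2 * π * u)) * v)) *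
    (v : ℂ) ^ (2 * j) with hψ
  have hψc : Continuous ψ := by rw [hψ]; fun_prop
  have hEq : ∀ v ∈ Ioi (0 : ℝ), H v + H (-v) = Set.indicator (Iio a) ψ v := by
    intro v hv
    rw [hH]; simp only
    rw [hj_neg, hj_eq_indicator_of_pos a j hv]
    by_cases hva : v < a
    · rw [Set.indicator_of_mem (show v ∈ Iio a from hva), Set.indicator_of_mem (show v ∈ Iio a from hva),
        hψ]
      simp only
      rw [show (↑(-2 * π * v * u) * I : ℂ) = I * (-(2 * π * u)) * v by push_cast; ring,
        show (↑(-2 * π * (-v) * u) * I : ℂ) = I * (2 * π * u) * v by push_cast; ring]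
      ring
    · rw [Set.indicator_of_notMem (show v ∉ Iio a from hva),
        Set.indicator_of_notMem (show v ∉ Iio a from hva)]
      simp
  rw [setIntegral_congr_fun measurableSet_Ioi hEq, setIntegral_indicator measurableSet_Iio,
    show Ioi (0 : ℝ) ∩ Iio a = Ioo 0 a from rfl, setIntegral_congr_set Ioo_ae_eq_Ioc,
    ← intervalIntegral.integral_of_le ha.le, hψ]
  simp only [add_mul]
  rw [intervalIntegral.integral_add ((by fun_prop : Continuous fun v : ℝ ↦ cexp (I * (2 * π * u) * v) *
      (v : ℂ) ^ (2 * j)).intervalIntegrable _ _) ((by fun_prop : Continuous fun v : ℝ ↦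
      cexp (I * (-(2 * π * u)) * v) * (v : ℂ) ^ (2 * j)).intervalIntegrable _ _), oscMoment, oscMoment]
  push_cast
  ring_nf


/-! ### L² plumbing (from scratch/F1) -/

/-- The multiplication formula on `L²(ℝ)`: `∫ (𝓕φ)ψ = ∫ φ(𝓕ψ)` (Burnol's `(𝓕₊(f), φ] = (f, 𝓕₊(φ)]` for the
euclidean pairing `(φ,ψ] = ∫ φψ`; from Parseval `⟪𝓕u,𝓕v⟫ = ⟪u,v⟫` and `𝓕 ∘ conj = conj ∘ 𝓕⁻`). [folklore] -/
private theorem integral_fourier_mul_eq (φ ψ : Lp ℂ 2 (volume : Measure ℝ)) :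
    ∫ x, ((𝓕 φ : Lp ℂ 2 (volume : Measure ℝ)) : ℝ → ℂ) x * (ψ : ℝ → ℂ) x =
      ∫ x, (φ : ℝ → ℂ) x * ((𝓕 ψ : Lp ℂ 2 (volume : Measure ℝ)) : ℝ → ℂ) x := by
  set J := ((starₗᵢ ℂ : ℂ ≃ₗᵢ⋆[ℂ] ℂ).toContinuousLinearEquiv : ℂ →L⋆[ℂ] ℂ).compLpL 2
    (volume : Measure ℝ) with hJ
  set v : Lp ℂ 2 (volume : Measure ℝ) := J φ with hv
  have hvcoe : (v : ℝ → ℂ) =ᵐ[volume] fun x ↦ conj ((φ : ℝ → ℂ) x) :=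
    Literature.Analysis.Fourier.coeFn_conjLp φ
  have h1 := Literature.Analysis.Fourier.fourierInv_conj_ae_eq hvcoe
  have e1 : inner ℂ (𝓕⁻ v : Lp ℂ 2 (volume : Measure ℝ)) ψ =
      ∫ x, ((𝓕 φ : Lp ℂ 2 (volume : Measure ℝ)) : ℝ → ℂ) x * (ψ : ℝ → ℂ) x := by
    rw [L2.inner_def]
    refine integral_congr_ae ?_
    filter_upwards [h1] with x hx
    simp only [RCLike.inner_apply']
    rw [hx, Complex.conj_conj]
  have e2 : inner ℂ (𝓕⁻ v : Lp ℂ 2 (volume : Measure ℝ)) ψ =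
      ∫ x, (φ : ℝ → ℂ) x * ((𝓕 ψ : Lp ℂ 2 (volume : Measure ℝ)) : ℝ → ℂ) x := by
    rw [← Lp.inner_fourier_eq, fourier_fourierInv_eq, L2.inner_def]
    refine integral_congr_ae ?_
    filter_upwards [hvcoe] with x hx
    simp only [RCLike.inner_apply']
    rw [hx, Complex.conj_conj]
  rw [← e1, e2]

/-- For an a.e.-even `L²` class, `𝓕𝓕F = F` (`𝓕𝓕 = R` and `RF = F`; Burnol's `𝓕₊² = 1` on `K`). [folklore] -/
private theorem fourier_fourier_of_even {F : Lp ℂ 2 (volume : Measure ℝ)}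
    (hF : ∀ᵐ x : ℝ, (F : ℝ → ℂ) (-x) = (F : ℝ → ℂ) x) :
    (𝓕 (𝓕 F : Lp ℂ 2 (volume : Measure ℝ)) : Lp ℂ 2 (volume : Measure ℝ)) = F := by
  rw [Literature.Analysis.Fourier.fourier_fourier_eq_compNeg]
  apply Lp.ext
  filter_upwards [Literature.Analysis.Fourier.coeFn_compNeg F, hF] with x h1 h2
  rw [h1, h2]

/-- Transport of an a.e. property along `x ↦ −x`. [folklore] -/
private theorem ae_comp_neg {p : ℝ → Prop} (h : ∀ᵐ x : ℝ, p x) : ∀ᵐ x : ℝ, p (-x) :=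
  (Measure.measurePreserving_neg (volume : Measure ℝ)).quasiMeasurePreserving.ae h

/-- For `h` integrable, a.e. even and a.e. zero on `[−b,b]`: `∫_ℝ h = 2∫_{(b,∞)} h`. [folklore] -/
private theorem integral_eq_two_mul_integral_Ioi {h : ℝ → ℂ} (hh : Integrable h)
    (heven : ∀ᵐ x : ℝ, h (-x) = h x) {b : ℝ} (hb : 0 ≤ b)
    (hzero : ∀ᵐ x : ℝ, x ∈ Icc (-b) b → h x = 0) :
    ∫ x, h x = 2 * ∫ x in Ioi b, h x := by
  rw [integral_eq_integral_Ioi_add_neg hh]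
  have e1 : ∫ x in Ioi 0, (h x + h (-x)) = ∫ x in Ioi 0, 2 * h x := by
    refine integral_congr_ae ?_
    filter_upwards [ae_restrict_of_ae (s := Ioi 0) heven] with x hx
    rw [hx]; ring
  rw [e1, integral_const_mul]
  congr 1
  have hI : IntegrableOn h (Ioi 0) := hh.integrableOn
  rw [← Ioc_union_Ioi_eq_Ioi hb, setIntegral_union (Set.Ioc_disjoint_Ioi le_rfl) measurableSet_Ioi
    (hI.mono_set Ioc_subset_Ioi_self) (hI.mono_set (Ioi_subset_Ioi hb))]
  have e2 : ∫ x in Ioc 0 b, h x = 0 := by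
    refine integral_eq_zero_of_ae ?_
    filter_upwards [ae_restrict_mem measurableSet_Ioc, ae_restrict_of_ae (s := Ioc 0 b) hzero]
      with x hx hz
    exact hz ⟨by linarith [hx.1], hx.2⟩
  rw [e2, zero_add]

/-- `‖F‖² = ∫ ‖F‖²` for an `L²(ℝ)` class. [folklore] -/
private theorem norm_sq_eq_integral (F : Lp ℂ 2 (volume : Measure ℝ)) :
    ‖F‖ ^ 2 = ∫ ξ : ℝ, ‖(F : ℝ → ℂ) ξ‖ ^ 2 := by
  have h1 : inner ℂ F F = ((‖F‖ ^ 2 : ℝ) : ℂ) := by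
    rw [inner_self_eq_norm_sq_to_K]; norm_cast
  have h2 : inner ℂ F F = ((∫ ξ : ℝ, ‖(F : ℝ → ℂ) ξ‖ ^ 2 : ℝ) : ℂ) := by
    rw [L2.inner_def, ← integral_complex_ofReal]
    refine integral_congr_ae (ae_of_all _ fun ξ ↦ ?_)
    beta_reduce
    rw [inner_self_eq_norm_sq_to_K]
    norm_cast
  exact_mod_cast Complex.ofReal_injective (h1.symm.trans h2)

/-- Cauchy–Schwarz on a half-line against an `L²(ℝ)` class: `‖∫_{(b,∞)} F·g‖ ≤ ‖F‖·(∫_{(b,∞)}‖g‖²)^{1/2}`.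
[folklore] -/
private theorem norm_setIntegral_mul_le (F : Lp ℂ 2 (volume : Measure ℝ)) {g : ℝ → ℂ} {b : ℝ}
    (hg : MemLp g 2 (volume.restrict (Ioi b))) :
    ‖∫ u in Ioi b, (F : ℝ → ℂ) u * g u‖ ≤
      ‖F‖ * (∫ u in Ioi b, ‖g u‖ ^ 2) ^ (1 / 2 : ℝ) := by
  have hF : MemLp (F : ℝ → ℂ) 2 (volume.restrict (Ioi b)) := (Lp.memLp F).restrict _
  have hpq : (2 : ℝ).HolderConjugate 2 := by
    constructor <;> norm_num
  have h1 := integral_mul_norm_le_Lp_mul_Lq (μ := volume.restrict (Ioi b)) hpq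
    (by simpa using hF) (by simpa using hg)
  simp only [Real.rpow_two] at h1
  have h2 : ‖∫ u in Ioi b, (F : ℝ → ℂ) u * g u‖ ≤ ∫ u in Ioi b, ‖(F : ℝ → ℂ) u‖ * ‖g u‖ := by
    refine (norm_integral_le_integral_norm _).trans (le_of_eq ?_)
    congr 1; ext u; exact norm_mul _ _
  refine h2.trans (h1.trans ?_)
  apply mul_le_mul_of_nonneg_right _ (by positivity)
  have h3 : (∫ u in Ioi b, ‖(F : ℝ → ℂ) u‖ ^ 2) ≤ ‖F‖ ^ 2 := by
    have : (∫ u in Ioi b, ‖(F : ℝ → ℂ) u‖ ^ 2) ≤ ∫ u, ‖(F : ℝ → ℂ) u‖ ^ 2 := by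
      apply setIntegral_le_integral
      · have := (Lp.memLp F).integrable_norm_rpow two_ne_zero ENNReal.ofNat_ne_top
        simpa using this
      · exact ae_of_all _ fun u ↦ by positivity
    rw [norm_sq_eq_integral F]; exact this
  calc (∫ u in Ioi b, ‖(F : ℝ → ℂ) u‖ ^ 2) ^ (1 / 2 : ℝ)
      ≤ (‖F‖ ^ 2) ^ (1 / 2 : ℝ) :=
        Real.rpow_le_rpow (integral_nonneg fun u ↦ by positivity) h3 (by norm_num)
    _ = ‖F‖ := by
        rw [← Real.sqrt_eq_rpow, Real.sqrt_sq (norm_nonneg _)]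


/-! ### M: the continuation `∫_{(b,∞)} F(u) 𝒞_a(u,w) du` -/

/-- Square-integrability of `u ↦ C_a(u,w)` on `(b,∞)` under the `O(1/u)` majorant. [folklore] -/
private theorem memLp_cosKernel {a b : ℝ} (ha : 0 < a) (hb : 0 < b) {K : ℝ} {w : ℂ}
    (hK : ∀ u : ℝ, b ≤ |u| → ‖cosKernel a u w‖ ≤ K / |u|) :
    MemLp (fun u : ℝ ↦ cosKernel a u w) 2 (volume.restrict (Ioi b)) ∧
      IntegrableOn (fun u : ℝ ↦ (K / |u|) ^ 2) (Ioi b) ∧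
      (∫ u in Ioi b, ‖cosKernel a u w‖ ^ 2) ≤ ∫ u in Ioi b, (K / |u|) ^ 2 := by
  have hmeas : AEStronglyMeasurable (fun u : ℝ ↦ cosKernel a u w) (volume.restrict (Ioi b)) :=
    ((continuousOn_cosKernel ha w).mono fun u (hu : b < u) ↦ (hb.trans hu).ne').aestronglyMeasurable
      measurableSet_Ioi
  have hint : IntegrableOn (fun u : ℝ ↦ (K / |u|) ^ 2) (Ioi b) := by
    have h1 : IntegrableOn (fun u : ℝ ↦ u ^ (-2 : ℝ)) (Ioi b) := integrableOn_Ioi_rpow_of_lt (by norm_num) hb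
    have h2 : IntegrableOn (fun u : ℝ ↦ K ^ 2 * u ^ (-2 : ℝ)) (Ioi b) := h1.const_mul (K ^ 2)
    refine h2.congr_fun (fun u hu ↦ ?_) measurableSet_Ioi
    have hu : 0 < u := hb.trans hu
    simp only [div_pow, abs_of_pos hu]
    rw [Real.rpow_neg hu.le, Real.rpow_two, div_eq_mul_inv]
  have hle : ∀ᵐ u ∂(volume.restrict (Ioi b)), ‖cosKernel a u w‖ ^ 2 ≤ (K / |u|) ^ 2 := by
    filter_upwards [ae_restrict_mem measurableSet_Ioi] with u hu
    have hu' : b ≤ |u| := by rw [abs_of_pos (hb.trans hu)]; exact hu.le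
    have h0 : 0 ≤ K / |u| := (norm_nonneg _).trans (hK u hu')
    exact pow_le_pow_left₀ (norm_nonneg _) (hK u hu') 2
  have hsq : Integrable (fun u : ℝ ↦ ‖cosKernel a u w‖ ^ 2) (volume.restrict (Ioi b)) := by
    refine Integrable.mono' hint (hmeas.norm.pow 2) ?_
    filter_upwards [hle] with u hu
    rw [Real.norm_eq_abs, abs_of_nonneg (by positivity)]
    exact hu
  exact ⟨(memLp_two_iff_integrable_sq_norm hmeas).mpr hsq, hint, integral_mono_ae hsq hint hle⟩


/-- Measurability of `u ↦ F(u)C_a(u,w)` on `(b,∞)`. [folklore] -/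
private theorem aestronglyMeasurable_mul_cosKernel {a b : ℝ} (ha : 0 < a) (hb : 0 < b)
    (F : Lp ℂ 2 (volume : Measure ℝ)) (w : ℂ) :
    AEStronglyMeasurable (fun u : ℝ ↦ (F : ℝ → ℂ) u * cosKernel a u w) (volume.restrict (Ioi b)) :=
  (Lp.aestronglyMeasurable F).restrict.mul
    (((continuousOn_cosKernel ha w).mono fun u (hu : b < u) ↦ (hb.trans hu).ne').aestronglyMeasurable
      measurableSet_Ioi)

/-- **`w ↦ G_F(w) = ∫_b^∞ F(u)C_a(u,w)du` is ENTIRE** for every `F ∈ L²(ℝ)` (`a, b > 0`): holomorphic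
parametric integral, dominated on `‖w‖ < R` by `|F(u)|·K_R/u ∈ L¹(b,∞)` (the `O(1/u)` clause of Lemme 1.3).
This is the analytic continuation "au plan complexe" of (1.2). [cite: Burnol2001CRAS, eq. (1.2) and Théorème 1.1 (TeX l.320–332)] -/
theorem differentiable_sonineMellinExt {a b : ℝ} (ha : 0 < a) (hb : 0 < b)
    (F : Lp ℂ 2 (volume : Measure ℝ)) :
    Differentiable ℂ (sonineMellinExt a b (F : ℝ → ℂ)) := by
  intro w₀
  set R : ℝ := ‖w₀‖ + 1 with hR
  obtain ⟨K, hK0, hK⟩ := exists_bound_cosKernel ha hb R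
  set U : Set ℂ := Metric.ball 0 R with hU
  have hw₀ : w₀ ∈ U := by rw [hU, Metric.mem_ball, dist_zero_right, hR]; linarith
  suffices h : DifferentiableOn ℂ (sonineMellinExt a b (F : ℝ → ℂ)) U from
    h.differentiableAt (Metric.isOpen_ball.mem_nhds hw₀)
  obtain ⟨-, hint, -⟩ := memLp_cosKernel ha hb (w := 0) (fun u hu ↦ hK u 0 hu (by simp; positivity))
  have hB : Integrable (fun u : ℝ ↦ ‖(F : ℝ → ℂ) u‖ * (K / |u|)) (volume.restrict (Ioi b)) := by
    have h1 : MemLp (fun u : ℝ ↦ ‖(F : ℝ → ℂ) u‖) 2 (volume.restrict (Ioi b)) :=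
      ((Lp.memLp F).restrict _).norm
    have h2 : MemLp (fun u : ℝ ↦ K / |u|) 2 (volume.restrict (Ioi b)) := by
      rw [memLp_two_iff_integrable_sq_norm (by
        refine (ContinuousOn.aestronglyMeasurable (fun u hu ↦ ?_) measurableSet_Ioi)
        exact (continuousAt_const.div (continuous_abs.continuousAt)
          (abs_pos.mpr (hb.trans hu).ne').ne').continuousWithinAt)]
      refine hint.congr_fun (fun u _ ↦ ?_) measurableSet_Ioi
      rw [Real.norm_eq_abs, sq_abs]
    exact h1.integrable_mul h2
  refine Literature.Analysis.Fourier.differentiableOn_integral_of_dominated_holomorphic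
    (μ := volume.restrict (Ioi b)) (K := fun w u ↦ (F : ℝ → ℂ) u * cosKernel a u w)
    Metric.isOpen_ball (fun w _ ↦ aestronglyMeasurable_mul_cosKernel ha hb F w) ?_ ?_ hB
  · filter_upwards [ae_restrict_mem measurableSet_Ioi] with u hu
    exact ((differentiable_cosKernel ha (hb.trans hu).ne').const_mul _).differentiableOn
  · filter_upwards [ae_restrict_mem measurableSet_Ioi] with u hu w hw
    rw [norm_mul]
    refine mul_le_mul_of_nonneg_left (hK u w ?_ ?_) (norm_nonneg _)
    · rw [abs_of_pos (hb.trans hu)]; exact hu.le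
    · rw [Metric.mem_ball, dist_zero_right] at hw; exact hw.le

/-- **Uniform bound**: `‖G_F(w)‖ ≤ C(a,b,R)·‖F‖_{L²(ℝ)}` for `‖w‖ ≤ R` (Cauchy–Schwarz on `(b,∞)`;
this is the continuity of the evaluations `f ↦ M(f)(w)`, Burnol 2004 Thm. 2.1 / de Branges). [cite: Burnol2001CRAS, eq. (1.2) and Théorème 1.1 (TeX l.320–332)] -/
theorem exists_bound_sonineMellinExt {a b : ℝ} (ha : 0 < a) (hb : 0 < b) (R : ℝ) :
    ∃ C : ℝ, 0 ≤ C ∧ ∀ (F : Lp ℂ 2 (volume : Measure ℝ)) (w : ℂ), ‖w‖ ≤ R →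
      ‖sonineMellinExt a b (F : ℝ → ℂ) w‖ ≤ C * ‖F‖ := by
  obtain ⟨K, hK0, hK⟩ := exists_bound_cosKernel ha hb R
  refine ⟨(∫ u in Ioi b, (K / |u|) ^ 2) ^ (1 / 2 : ℝ), by positivity, fun F w hw ↦ ?_⟩
  obtain ⟨hmem, hint, hle⟩ := memLp_cosKernel ha hb (w := w) (fun u hu ↦ hK u w hu hw)
  rw [sonineMellinExt, mul_comm]
  refine (norm_setIntegral_mul_le F hmem).trans ?_
  gcongr

/-- For `f ∈ L²(ℝ)` a.e. even and a.e. zero on `[−a,a]` and `Re w < 1/2`: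
`∫_0^∞ f(t)t^{w−1}dt = ½∫_ℝ f·g_w` with `g_w = |x|^{w−1}𝟙_{|x|>a}` (the pairing `(f, 𝟙_{t≥a}t^{w−1}]`). [cite: Burnol2001CRAS, eq. (1.2) and Théorème 1.1 (TeX l.320–332)] -/
theorem mellin_eq_half_integral {a : ℝ} (ha : 0 < a) (f : Lp ℂ 2 (volume : Measure ℝ))
    (heven : ∀ᵐ x : ℝ, (f : ℝ → ℂ) (-x) = (f : ℝ → ℂ) x)
    (hfa : ∀ᵐ x : ℝ, x ∈ Icc (-a) a → (f : ℝ → ℂ) x = 0) {w : ℂ} (hw : w.re < 1 / 2) :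
    mellin (f : ℝ → ℂ) w = (1 / 2) * ∫ x, (f : ℝ → ℂ) x * (Set.indicator {x : ℝ | a < |x|} (fun x : ℝ ↦ ((|x| : ℝ) : ℂ) ^ (w - 1))) x := by
  have hint : Integrable (fun x ↦ (f : ℝ → ℂ) x * (Set.indicator {x : ℝ | a < |x|} (fun x : ℝ ↦ ((|x| : ℝ) : ℂ) ^ (w - 1))) x) :=
    (Lp.memLp f).integrable_mul (memLp_gw ha hw)
  rw [integral_eq_integral_Ioi_add_neg hint]
  have e1 : ∫ x in Ioi 0, ((f : ℝ → ℂ) x * (Set.indicator {x : ℝ | a < |x|} (fun x : ℝ ↦ ((|x| : ℝ) : ℂ) ^ (w - 1))) x + (f : ℝ → ℂ) (-x) * (Set.indicator {x : ℝ | a < |x|} (fun x : ℝ ↦ ((|x| : ℝ) : ℂ) ^ (w - 1))) (-x)) =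
      ∫ x in Ioi 0, 2 * ((f : ℝ → ℂ) x * (Set.indicator {x : ℝ | a < |x|} (fun x : ℝ ↦ ((|x| : ℝ) : ℂ) ^ (w - 1))) x) := by
    refine integral_congr_ae ?_
    filter_upwards [ae_restrict_of_ae (s := Ioi 0) heven] with x hx
    rw [hx, gw_neg]; ring
  rw [e1, integral_const_mul, mellin]
  have e2 : ∫ t : ℝ in Ioi 0, ((t : ℂ) ^ (w - 1) • (f : ℝ → ℂ) t) =
      ∫ x in Ioi 0, (f : ℝ → ℂ) x * (Set.indicator {x : ℝ | a < |x|} (fun x : ℝ ↦ ((|x| : ℝ) : ℂ) ^ (w - 1))) x := by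
    refine integral_congr_ae ?_
    filter_upwards [ae_restrict_mem measurableSet_Ioi, ae_restrict_of_ae (s := Ioi 0) hfa] with x hx hz
    rw [gw_eq_indicator_of_pos a w hx, smul_eq_mul]
    by_cases hxa : a < x
    · rw [Set.indicator_of_mem (show x ∈ Ioi a from hxa)]; ring
    · have hx' : (0 : ℝ) < x := hx
      rw [Set.indicator_of_notMem (show x ∉ Ioi a from hxa), hz ⟨by linarith, le_of_not_gt hxa⟩]
      ring
  rw [e2]; ring


section Main

variable {a b : ℝ} (ha : 0 < a) (hb : 0 < b) (f : Lp ℂ 2 (volume : Measure ℝ))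
  (heven : ∀ᵐ x : ℝ, (f : ℝ → ℂ) (-x) = (f : ℝ → ℂ) x)
  (hfa : ∀ᵐ x : ℝ, x ∈ Icc (-a) a → (f : ℝ → ℂ) x = 0)
  (hFb : ∀ᵐ x : ℝ, x ∈ Icc (-b) b → ((𝓕 f : Lp ℂ 2 (volume : Measure ℝ)) : ℝ → ℂ) x = 0)

include ha hb heven hfa hFb in
/-- **Burnol's identity (1.2) on `Re w < 0`**: for `f ∈ K_{a,b}` (even, `f = 0` a.e. on `[−a,a]`,
`𝓕f = 0` a.e. on `[−b,b]`), `∫_0^∞ f(t)t^{w−1}dt = ∫_b^∞ 𝓕f(u)·C_a(u,w)du` — "Cette identité est tout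
d'abord établie pour `Re(s) < 0`" (multiplication formula + the explicit transform of `g_w`). [cite: Burnol2001CRAS, eq. (1.2) and Théorème 1.1 (TeX l.320–332)] -/
theorem sonineMellinExt_eq_mellin_of_neg {w : ℂ} (hw : w.re < 0) :
    sonineMellinExt a b ((𝓕 f : Lp ℂ 2 (volume : Measure ℝ)) : ℝ → ℂ) w = mellin (f : ℝ → ℂ) w := by
  set F : Lp ℂ 2 (volume : Measure ℝ) := 𝓕 f with hFdef
  have hFF : (𝓕 F : Lp ℂ 2 (volume : Measure ℝ)) = f := fourier_fourier_of_even heven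
  have hFeven : ∀ᵐ x : ℝ, (F : ℝ → ℂ) (-x) = (F : ℝ → ℂ) x :=
    fourier_even heven
  have hw' : w.re < 1 / 2 := by linarith
  -- the `L²` class of `g_w` and its Fourier transform
  have hg1 := integrable_gw ha hw
  have hg2 := memLp_gw ha hw'
  set g : Lp ℂ 2 (volume : Measure ℝ) := hg2.toLp (Set.indicator {x : ℝ | a < |x|} (fun x : ℝ ↦ ((|x| : ℝ) : ℂ) ^ (w - 1))) with hgdef
  have hgcoe : (g : ℝ → ℂ) =ᵐ[volume] (Set.indicator {x : ℝ | a < |x|} (fun x : ℝ ↦ ((|x| : ℝ) : ℂ) ^ (w - 1))) := hg2.coeFn_toLp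
  have hFg : ((𝓕 g : Lp ℂ 2 (volume : Measure ℝ)) : ℝ → ℂ) =ᵐ[volume] fun u ↦ cosKernel a u w := by
    have h1 := Literature.Analysis.FunctionSpaces.fourier_toLp_ae_eq_fourierIntegral hg1 hg2
    have h2 : ∀ᵐ u : ℝ, u ≠ 0 := by
      have : (volume : Measure ℝ) {0} = 0 := measure_singleton 0
      filter_upwards [measure_eq_zero_iff_ae_notMem.1 this] with u hu
      simpa using hu
    filter_upwards [h1, h2] with u hu hu0
    rw [hu, fourierIntegral_gw ha hw hu0]
  -- step 1: Mellin = ½ ∫ f g_w = ½ ∫ (𝓕F) g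
  rw [mellin_eq_half_integral ha f heven hfa hw']
  have e1 : ∫ x, (f : ℝ → ℂ) x * (Set.indicator {x : ℝ | a < |x|} (fun x : ℝ ↦ ((|x| : ℝ) : ℂ) ^ (w - 1))) x =
      ∫ x, ((𝓕 F : Lp ℂ 2 (volume : Measure ℝ)) : ℝ → ℂ) x * (g : ℝ → ℂ) x := by
    rw [hFF]
    refine integral_congr_ae ?_
    filter_upwards [hgcoe] with x hx
    rw [hx]
  -- step 2: multiplication formula, then the explicit Fourier transform
  have e2 : ∫ x, (F : ℝ → ℂ) x * ((𝓕 g : Lp ℂ 2 (volume : Measure ℝ)) : ℝ → ℂ) x =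
      ∫ x, (F : ℝ → ℂ) x * cosKernel a x w := by
    refine integral_congr_ae ?_
    filter_upwards [hFg] with x hx
    rw [hx]
  -- step 3: evenness and vanishing on `[-b, b]`
  have hint : Integrable (fun x ↦ (F : ℝ → ℂ) x * cosKernel a x w) := by
    have : Integrable (fun x ↦ (F : ℝ → ℂ) x * ((𝓕 g : Lp ℂ 2 (volume : Measure ℝ)) : ℝ → ℂ) x) :=
      (Lp.memLp F).integrable_mul (Lp.memLp _)
    refine this.congr ?_
    filter_upwards [hFg] with x hx
    rw [hx]
  have e3 : ∫ x, (F : ℝ → ℂ) x * cosKernel a x w =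
      2 * ∫ x in Ioi b, (F : ℝ → ℂ) x * cosKernel a x w := by
    refine integral_eq_two_mul_integral_Ioi hint ?_ hb.le ?_
    · filter_upwards [hFeven] with x hx
      rw [hx, cosKernel_neg]
    · filter_upwards [hFb] with x hx hxI
      rw [hx hxI, zero_mul]
  rw [e1, integral_fourier_mul_eq, e2, e3, sonineMellinExt]
  ring

include ha hfa in
/-- For `f ∈ L²(ℝ)` a.e. zero on `[−a,a]` (`a > 0`), `w ↦ ∫_0^∞ f(t)t^{w−1}dt` is holomorphic on
`Re w < 1/2` ("Si `f` est presque partout nulle sur `]0,a]` alors `∫f(t)t^{s−1}dt` est analytique dans le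
demi-plan `Re(s) < 1/2`", TeX l.288–290). [cite: Burnol2001CRAS, §1 (TeX l.288–290)] -/
theorem differentiableOn_mellin : DifferentiableOn ℂ (mellin (f : ℝ → ℂ)) {w | w.re < 1 / 2} := by
  -- rewrite the Mellin integral over `(a, ∞)`
  have hmel : ∀ w : ℂ, mellin (f : ℝ → ℂ) w = ∫ t in Ioi a, (t : ℂ) ^ (w - 1) * (f : ℝ → ℂ) t := by
    intro w
    rw [mellin]
    have hI : ∫ t : ℝ in Ioi 0, (t : ℂ) ^ (w - 1) • (f : ℝ → ℂ) t =
        ∫ t : ℝ in Ioi 0, Set.indicator (Ioi a) (fun t : ℝ ↦ (t : ℂ) ^ (w - 1) * (f : ℝ → ℂ) t) t := by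
      refine integral_congr_ae ?_
      filter_upwards [ae_restrict_mem measurableSet_Ioi, ae_restrict_of_ae (s := Ioi 0) hfa]
        with x hx hz
      by_cases hxa : a < x
      · rw [Set.indicator_of_mem (show x ∈ Ioi a from hxa), smul_eq_mul]
      · have hx' : (0 : ℝ) < x := hx
        rw [Set.indicator_of_notMem (show x ∉ Ioi a from hxa), smul_eq_mul,
          hz ⟨by linarith, le_of_not_gt hxa⟩, mul_zero]
    rw [hI, setIntegral_indicator measurableSet_Ioi,
      show Ioi (0 : ℝ) ∩ Ioi a = Ioi a from by rw [Set.inter_eq_right]; exact Ioi_subset_Ioi ha.le]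
  have hfun : mellin (f : ℝ → ℂ) = fun w ↦ ∫ t in Ioi a, (t : ℂ) ^ (w - 1) * (f : ℝ → ℂ) t :=
    funext hmel
  rw [hfun]
  intro w₀ hw₀
  set ε : ℝ := (1 / 2 - w₀.re) / 2 with hε
  have hε0 : 0 < ε := by simp only [mem_setOf_eq] at hw₀; rw [hε]; linarith
  set R : ℝ := |w₀.re| + 1 with hR
  set U : Set ℂ := {w | -R < w.re ∧ w.re < 1 / 2 - ε} with hU
  have hUo : IsOpen U :=
    (isOpen_lt continuous_const Complex.continuous_re).inter
      (isOpen_lt Complex.continuous_re continuous_const)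
  have hw₀U : w₀ ∈ U := by
    refine ⟨?_, ?_⟩
    · have := neg_abs_le w₀.re; rw [hR]; linarith
    · rw [hε]; simp only [mem_setOf_eq] at hw₀; linarith
  suffices h : DifferentiableOn ℂ (fun w ↦ ∫ t in Ioi a, (t : ℂ) ^ (w - 1) * (f : ℝ → ℂ) t) U from
    (h w₀ hw₀U).differentiableAt (hUo.mem_nhds hw₀U) |>.differentiableWithinAt
  -- the majorant `M · t^{-1/2-ε} · ‖f t‖` on `(a, ∞)`
  set M : ℝ := max 1 (a ^ (-R - 1)) with hM
  have hM1 : 1 ≤ M := le_max_left _ _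
  have hmaj : ∀ t : ℝ, a < t → ∀ w ∈ U, t ^ (w.re - 1) ≤ M * t ^ (-1 / 2 - ε) := by
    intro t ht w hw
    have ht0 : 0 < t := ha.trans ht
    rcases le_or_gt 1 t with ht1 | ht1
    · calc t ^ (w.re - 1) ≤ t ^ (-1 / 2 - ε) :=
            Real.rpow_le_rpow_of_exponent_le ht1 (by linarith [hw.2])
        _ ≤ M * t ^ (-1 / 2 - ε) := le_mul_of_one_le_left (Real.rpow_nonneg ht0.le _) hM1
    · calc t ^ (w.re - 1) ≤ t ^ (-R - 1) :=
            Real.rpow_le_rpow_of_exponent_ge ht0 ht1.le (by linarith [hw.1])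
        _ ≤ a ^ (-R - 1) := by
            apply Real.rpow_le_rpow_of_nonpos ha ht.le
            have := abs_nonneg w₀.re; rw [hR]; linarith
        _ ≤ M := le_max_right _ _
        _ ≤ M * t ^ (-1 / 2 - ε) := by
            apply le_mul_of_one_le_right (by linarith)
            exact Real.one_le_rpow_of_pos_of_le_one_of_nonpos ht0 ht1.le (by linarith)
  have hB : Integrable (fun t : ℝ ↦ (M * t ^ (-1 / 2 - ε)) * ‖(f : ℝ → ℂ) t‖)
      (volume.restrict (Ioi a)) := by
    have h1 : MemLp (fun t : ℝ ↦ M * t ^ (-1 / 2 - ε)) 2 (volume.restrict (Ioi a)) := by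
      have hc : ContinuousOn (fun t : ℝ ↦ M * t ^ (-1 / 2 - ε)) (Ioi a) := fun t ht ↦
        (continuousAt_const.mul (Real.continuousAt_rpow_const _ _
          (Or.inl (ha.trans ht).ne'))).continuousWithinAt
      rw [memLp_two_iff_integrable_sq_norm (hc.aestronglyMeasurable measurableSet_Ioi)]
      have h2 : IntegrableOn (fun t : ℝ ↦ M ^ 2 * t ^ (-1 - 2 * ε)) (Ioi a) :=
        (integrableOn_Ioi_rpow_of_lt (by linarith) ha).const_mul _
      refine h2.congr_fun (fun t ht ↦ ?_) measurableSet_Ioi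
      have ht0 : 0 < t := ha.trans ht
      simp only [Real.norm_eq_abs, sq_abs, mul_pow]
      congr 1
      rw [← Real.rpow_natCast (t ^ (-1 / 2 - ε)) 2, ← Real.rpow_mul ht0.le]
      congr 1; push_cast; ring
    have h2 : MemLp (fun t : ℝ ↦ ‖(f : ℝ → ℂ) t‖) 2 (volume.restrict (Ioi a)) :=
      ((Lp.memLp f).restrict _).norm
    exact h1.integrable_mul h2
  refine Literature.Analysis.Fourier.differentiableOn_integral_of_dominated_holomorphic
    (μ := volume.restrict (Ioi a)) (K := fun w t ↦ (t : ℂ) ^ (w - 1) * (f : ℝ → ℂ) t) hUo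
    ?_ ?_ ?_ hB
  · intro w _
    refine (ContinuousOn.aestronglyMeasurable (fun t ht ↦ ?_) measurableSet_Ioi).mul
      (Lp.aestronglyMeasurable f).restrict
    exact (continuousAt_ofReal_cpow_const _ _ (Or.inr (ha.trans ht).ne')).continuousWithinAt
  · filter_upwards [ae_restrict_mem measurableSet_Ioi] with t ht
    have ht0 : (t : ℂ) ≠ 0 := ofReal_ne_zero.mpr (ha.trans ht).ne'
    exact fun w _ ↦ (((differentiableAt_id.sub_const (1 : ℂ)).const_cpow (Or.inl ht0)).mul_const
      ((f : ℝ → ℂ) t)).differentiableWithinAt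
  · filter_upwards [ae_restrict_mem measurableSet_Ioi] with t ht w hw
    rw [norm_mul, norm_cpow_eq_rpow_re_of_pos (ha.trans ht)]
    simp only [sub_re, one_re]
    exact mul_le_mul_of_nonneg_right (hmaj t ht w hw) (norm_nonneg _)


include ha hb heven hfa hFb in
/-- **(1.2) on the whole half-plane of convergence**: for `f ∈ K_{a,b}` and `Re w < 1/2`,
`∫_b^∞ 𝓕f(u)C_a(u,w)du = ∫_0^∞ f(t)t^{w−1}dt` (identity theorem from `Re w < 0`; "donne le prolongement
analytique de `f̂(s)`"). [cite: Burnol2001CRAS, eq. (1.2) and Théorème 1.1 (TeX l.320–332)] -/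
theorem sonineMellinExt_eq_mellin {w : ℂ} (hw : w.re < 1 / 2) :
    sonineMellinExt a b ((𝓕 f : Lp ℂ 2 (volume : Measure ℝ)) : ℝ → ℂ) w = mellin (f : ℝ → ℂ) w := by
  set U : Set ℂ := {w | w.re < 1 / 2} with hU
  have hUo : IsOpen U := isOpen_lt Complex.continuous_re continuous_const
  have hconn : IsPreconnected U := (convex_halfSpace_re_lt (1 / 2 : ℝ)).isPreconnected
  have h1 : AnalyticOnNhd ℂ (sonineMellinExt a b ((𝓕 f : Lp ℂ 2 (volume : Measure ℝ)) : ℝ → ℂ)) U :=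
    (differentiable_sonineMellinExt ha hb _).differentiableOn.analyticOnNhd hUo
  have h2 : AnalyticOnNhd ℂ (mellin (f : ℝ → ℂ)) U := (differentiableOn_mellin ha f hfa).analyticOnNhd hUo
  have hz₀ : (-1 : ℂ) ∈ U := by simp [hU]; norm_num
  have hV : IsOpen {w : ℂ | w.re < 0} := isOpen_lt Complex.continuous_re continuous_const
  have hev : sonineMellinExt a b ((𝓕 f : Lp ℂ 2 (volume : Measure ℝ)) : ℝ → ℂ) =ᶠ[𝓝 (-1 : ℂ)]
      mellin (f : ℝ → ℂ) := by
    filter_upwards [hV.mem_nhds (by simp : (-1 : ℂ) ∈ {w : ℂ | w.re < 0})] with z hz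
    exact sonineMellinExt_eq_mellin_of_neg ha hb f heven hfa hFb hz
  exact h1.eqOn_of_preconnected_of_eventuallyEq h2 hconn hz₀ hev hw

include ha hb heven hfa hFb in
/-- **Trivial zeros**: for `f ∈ K_{a,b}` the entire continuation of `f̂` vanishes at `1 + 2j`, `j ∈ ℕ`
("possèdent en `1, 3, 5, …` des zéros triviaux"): `C_a(u,1+2j) = −𝓕(h_j)(u)` and
`∫ 𝓕f·𝓕h_j = ∫ f·h_j = 0` since `h_j` lives on `(−a,a)`. [cite: Burnol2001CRAS, Théorème 1.4 (TeX l.369–386)] -/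
theorem sonineMellinExt_one_add_two_mul (j : ℕ) :
    sonineMellinExt a b ((𝓕 f : Lp ℂ 2 (volume : Measure ℝ)) : ℝ → ℂ) (1 + 2 * j) = 0 := by
  set F : Lp ℂ 2 (volume : Measure ℝ) := 𝓕 f with hFdef
  have hFF : (𝓕 F : Lp ℂ 2 (volume : Measure ℝ)) = f := fourier_fourier_of_even heven
  have hFeven : ∀ᵐ x : ℝ, (F : ℝ → ℂ) (-x) = (F : ℝ → ℂ) x :=
    fourier_even heven
  have hh1 := integrable_hj a j
  have hh2 := memLp_hj a j
  set h : Lp ℂ 2 (volume : Measure ℝ) := hh2.toLp (Set.indicator {x : ℝ | |x| < a} (fun x : ℝ ↦ (x : ℂ) ^ (2 * j))) with hhdef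
  have hhcoe : (h : ℝ → ℂ) =ᵐ[volume] (Set.indicator {x : ℝ | |x| < a} (fun x : ℝ ↦ (x : ℂ) ^ (2 * j))) := hh2.coeFn_toLp
  have hFh : ((𝓕 h : Lp ℂ 2 (volume : Measure ℝ)) : ℝ → ℂ) =ᵐ[volume]
      fun u ↦ oscMoment (2 * π * u) a (2 * j) + oscMoment (-(2 * π * u)) a (2 * j) := by
    filter_upwards [Literature.Analysis.FunctionSpaces.fourier_toLp_ae_eq_fourierIntegral hh1 hh2]
      with u hu
    rw [hu, fourierIntegral_hj ha j u]
  -- the integrable function `φ = F · 𝓕h`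
  set φ : ℝ → ℂ := fun u ↦ (F : ℝ → ℂ) u * ((𝓕 h : Lp ℂ 2 (volume : Measure ℝ)) : ℝ → ℂ) u with hφ
  have hφi : Integrable φ := (Lp.memLp F).integrable_mul (Lp.memLp _)
  -- `∫_{Ioi b} F·𝒞(·,1+2j) = -∫_{Ioi b} φ`
  have e1 : sonineMellinExt a b (F : ℝ → ℂ) (1 + 2 * j) = -∫ u in Ioi b, φ u := by
    rw [sonineMellinExt, ← integral_neg]
    refine integral_congr_ae ?_
    filter_upwards [ae_restrict_mem measurableSet_Ioi, ae_restrict_of_ae (s := Ioi b) hFh] with u hu hFu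
    rw [hφ]; simp only
    rw [hFu, cosKernel_one_add_two_mul ha (hb.trans hu).ne' j]
    ring
  -- `∫_ℝ φ = 2 ∫_{Ioi b} φ`
  have e2 : ∫ u, φ u = 2 * ∫ u in Ioi b, φ u := by
    refine integral_eq_two_mul_integral_Ioi hφi ?_ hb.le ?_
    · filter_upwards [hFeven, hFh, ae_comp_neg hFh] with x hx h1 h2
      rw [hφ]; simp only
      rw [hx, h1, h2]
      ring_nf
    · filter_upwards [hFb] with x hx hxI
      rw [hφ]; simp only
      rw [hx hxI, zero_mul]
  -- `∫_ℝ φ = ∫ (𝓕F) h = ∫ f h_j = 0`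
  have e3 : ∫ u, φ u = 0 := by
    rw [hφ]
    simp only
    rw [← integral_fourier_mul_eq F h, hFF]
    refine integral_eq_zero_of_ae ?_
    filter_upwards [hhcoe, hfa] with x hx hz
    rw [hx]
    simp only [Set.indicator, mem_setOf_eq, Pi.zero_apply]
    split_ifs with hxa
    · rw [hz ⟨by linarith [(abs_lt.mp hxa).1], (abs_lt.mp hxa).2.le⟩, zero_mul]
    · rw [mul_zero]
  have : ∫ u in Ioi b, φ u = 0 := by
    have h4 : (2 : ℂ) * ∫ u in Ioi b, φ u = 0 := by rw [← e2, e3]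
    simpa using h4
  rw [hFdef] at e1
  rw [e1, this, neg_zero]

end Main

end SonineMellin

/-! ## Théorème 1.1 and the first clause of Théorème 1.4 -/

namespace Burnol2001

open Literature.NumberTheory.ConnesConsani2021 (soninSpace)

/-- **Théorème 1.1 holds** (de Branges 1964 / Burnol 2001): every `f ∈ K_{a,b}` (`a, b > 0`) has an
ENTIRE continuation of its Mellin transform `∫_0^∞ f(t)t^{s−1}dt` from the half-plane `Re s < 1/2`, namely
`G(w) = ∫_b^∞ 𝓕f(u)·C_a(u,w)du`. [cite: Burnol2001CRAS, Théorème 1.1 (TeX l.320–332); deBranges1964] -/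
theorem Burnol2001CRAS_thm1_1_holds : Burnol2001CRAS_thm1_1 := by
  intro a b ha hb f hf
  obtain ⟨heven, hfa, hFb⟩ := hf
  exact ⟨SonineMellin.sonineMellinExt a b ((𝓕 f : Lp ℂ 2 (volume : Measure ℝ)) : ℝ → ℂ),
    SonineMellin.differentiable_sonineMellinExt ha hb _,
    fun s hs ↦ SonineMellin.sonineMellinExt_eq_mellin ha hb f heven hfa hFb hs⟩

/-- **Théorème 1.4, first clause**: for `f ∈ K_{a,b}`, EVERY entire continuation `G` of `f̂` vanishes at
`1 + 2j`, `j ∈ ℕ` ("possèdent en `1, 3, 5, …` des zéros triviaux"; uniqueness of the continuation + the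
terminating integration by parts). The second clause of the typed fact `Burnol2001CRAS_thm1_4` ("ce sont
leurs seuls zéros communs") is not proved here. [cite: Burnol2001CRAS, Théorème 1.4 (TeX l.369–386)] -/
theorem Burnol2001CRAS_thm1_4_i {a b : ℝ} (ha : 0 < a) (hb : 0 < b) (f : Lp ℂ 2 (volume : Measure ℝ))
    (hf : f ∈ soninSpace a b) (G : ℂ → ℂ) (hG : HasEntireMellin f G) (j : ℕ) :
    G (1 + 2 * j) = 0 := by
  obtain ⟨heven, hfa, hFb⟩ := hf
  set G' := SonineMellin.sonineMellinExt a b ((𝓕 f : Lp ℂ 2 (volume : Measure ℝ)) : ℝ → ℂ) with hG'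
  have hG'd : Differentiable ℂ G' := SonineMellin.differentiable_sonineMellinExt ha hb _
  have hV : IsOpen {w : ℂ | w.re < 1 / 2} := isOpen_lt Complex.continuous_re continuous_const
  have hev : G =ᶠ[𝓝 (0 : ℂ)] G' := by
    filter_upwards [hV.mem_nhds (by simp : (0 : ℂ) ∈ {w : ℂ | w.re < 1 / 2})] with z hz
    rw [hG.2 z hz, hG', SonineMellin.sonineMellinExt_eq_mellin ha hb f heven hfa hFb hz]
  have hEq := hG.1.differentiableOn.analyticOnNhd isOpen_univ |>.eqOn_of_preconnected_of_eventuallyEq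
    (hG'd.differentiableOn.analyticOnNhd isOpen_univ) isPreconnected_univ (mem_univ 0) hev
  rw [hEq (mem_univ _), hG']
  exact SonineMellin.sonineMellinExt_one_add_two_mul ha hb f heven hfa hFb j

end Burnol2001

end Literature.Analysis.DeBrangesSpaces
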